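import Summits.QuantumFields.QCD.Theorems.GaussianLinkFramesFrameFMClosurePlacementCollarAux4

/-!
# Crux `GaussianLinkFrames.FrameFMClosure` (stmt-QuantumFields-17375), line `pad-the-fibre`, stub
`stub_placementCollar` — helper 5: the integer chart of the odd torus about the collar centre

Dictionary between the integer placement of helpers 1–4 and the torus-side vocabulary of the line
(`starLinks`, `padLinks`, `padFrozen`, `IsPadRegion`, `touched`, `Balanced`, `ebox`).  With `φ a := x + proj a`
(`x` the collar centre, torus of side `2S+1`): `φ` is injective on the window `[-S, S]⁴` and inverted there by
`valMinAbs` (`chart_inj`, `chart_val`); stars, touched sets and even boxes are images under `φ` (`starLinks_chart`,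
`touched_univ_chart`, `mem_ebox_chart`, `mem_ebox_core_chart`); a region canonical in the chart is a canonical pad
region on the torus (`isPadRegion_chart`); and a finite window set carrying a nearest-neighbour involution has
balanced image (`balanced_chart_image`, by `PadTheFibreTwoStar.card_filter_eq_of_pairing`).

References: elementary [folklore]; the vocabulary is the line card of `pad-the-fibre`.
-/

noncomputable section

open scoped BigOperators
open Literature.MathematicalPhysics.QuantumFieldTheory Literature.MathematicalPhysics.QuantumLattice
  Literature.Probability.LatticeModels
open Summit.QuantumFields.QCD.Theorems.VonMisesCircles Summit.QuantumFields.QCD.Theorems.PadTheFibre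
  Summit.QuantumFields.QCD.Theorems.PadTheFibreTwoStar

namespace Summit.QuantumFields.QCD.Theorems.PadTheFibreCollar

/-- `proj` is additive. [folklore] -/
theorem proj_add' (L : ℕ) (a a' : Literature.Probability.LatticeModels.Site 4) :
    Torus.proj L (a + a') = Torus.proj L a + Torus.proj L a' := by
  funext i; simp

/-- `proj` respects subtraction. [folklore] -/
theorem proj_sub' (L : ℕ) (a a' : Literature.Probability.LatticeModels.Site 4) :
    Torus.proj L (a - a') = Torus.proj L a - Torus.proj L a' := by
  funext i; simp

/-- **The chart is injective on the window `[-S, S]⁴`.** [folklore] -/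
theorem chart_inj {S : ℕ} (x : TorusSite 4 (2 * S + 1)) (a a' : Literature.Probability.LatticeModels.Site 4)
    (ha : ∀ i, -(S : ℤ) ≤ a i ∧ a i ≤ S) (ha' : ∀ i, -(S : ℤ) ≤ a' i ∧ a' i ≤ S)
    (h : x + Torus.proj (2 * S + 1) a = x + Torus.proj (2 * S + 1) a') : a = a' := by
  funext i
  have hi := congrFun h i
  simp only [Pi.add_apply, Torus.proj_apply, add_right_inj] at hi
  refine (intCast_eq_intCast_iff_of_abs_sub_lt ?_).1 hi
  have h1 := ha i; have h2 := ha' i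
  rw [abs_lt]; push_cast; constructor <;> linarith

/-- **The chart is inverted by `valMinAbs`**: every site is `φ` of its balanced offset, which lies in the window,
and the balanced offset of `φ a` is `a` for `a` in the window. [folklore] -/
theorem chart_val {S : ℕ} (x : TorusSite 4 (2 * S + 1)) :
    (∀ z : TorusSite 4 (2 * S + 1),
      x + Torus.proj (2 * S + 1) (fun i => ((z i - x i).valMinAbs : ℤ)) = z ∧
      ∀ i, -(S : ℤ) ≤ (z i - x i).valMinAbs ∧ (z i - x i).valMinAbs ≤ S) ∧
    ∀ a : Literature.Probability.LatticeModels.Site 4, (∀ i, -(S : ℤ) ≤ a i ∧ a i ≤ S) →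
      (fun i => (((x + Torus.proj (2 * S + 1) a) i - x i).valMinAbs : ℤ)) = a := by
  haveI : NeZero (2 * S + 1) := ⟨by omega⟩
  have h1 : ∀ z : TorusSite 4 (2 * S + 1),
      x + Torus.proj (2 * S + 1) (fun i => ((z i - x i).valMinAbs : ℤ)) = z ∧
      ∀ i, -(S : ℤ) ≤ (z i - x i).valMinAbs ∧ (z i - x i).valMinAbs ≤ S := by
    intro z
    refine ⟨?_, fun i => ?_⟩
    · funext i; simp [ZMod.coe_valMinAbs]
    · have hb := ZMod.natAbs_valMinAbs_le (z i - x i)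
      have hS : (2 * S + 1) / 2 = S := by omega
      rw [hS] at hb
      have : |((z i - x i).valMinAbs : ℤ)| ≤ S := by rw [Int.abs_eq_natAbs]; exact_mod_cast hb
      exact abs_le.1 this
  refine ⟨h1, fun a ha => ?_⟩
  exact chart_inj x _ a (h1 _).2 ha (h1 _).1

/-- **Stars in the chart**: the star of `φ a` is the image of `{(a, μ), (a - e_μ, μ) : μ}`. [folklore] -/
theorem starLinks_chart {S : ℕ} (x : TorusSite 4 (2 * S + 1)) (a : Literature.Probability.LatticeModels.Site 4) :
    starLinks S (x + Torus.proj (2 * S + 1) a) =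
      ((Finset.univ.image fun μ : Fin 4 => (a, μ)) ∪
        (Finset.univ.image fun μ : Fin 4 => (a - Pi.single μ 1, μ))).image
        fun q : Literature.Probability.LatticeModels.Site 4 × Fin 4 => ((x + Torus.proj (2 * S + 1) q.1, q.2) : Edge 4 (2 * S + 1)) := by
  classical
  ext ⟨z, μ⟩
  simp only [starLinks, Finset.mem_filter, Finset.mem_univ, true_and, Finset.mem_image, Finset.mem_union,
    Prod.mk.injEq]
  constructor
  · rintro (rfl | h)
    · exact ⟨(a, μ), Or.inl ⟨μ, rfl⟩, rfl, rfl⟩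
    · refine ⟨(a - Pi.single μ 1, μ), Or.inr ⟨μ, rfl⟩, ?_, rfl⟩
      have hz : z = x + Torus.proj (2 * S + 1) a - Pi.single μ 1 := eq_sub_of_add_eq h
      rw [hz, (proj_add_single_sub_single _ a μ).2, add_sub_assoc]
  · rintro ⟨q, (⟨ν, rfl⟩ | ⟨ν, rfl⟩), h1, rfl⟩
    · exact Or.inl h1.symm
    · right
      show z + Pi.single ν 1 = _
      rw [← h1, (proj_add_single_sub_single _ a ν).2]
      abel

/-- **Touched sets in the chart** (side `univ`): the touched set of an image region is the image of its integer
endpoints. [folklore] -/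
theorem touched_univ_chart {S : ℕ} (x : TorusSite 4 (2 * S + 1))
    (R : Finset (Literature.Probability.LatticeModels.Site 4 × Fin 4)) :
    touched S Finset.univ (R.image fun q : Literature.Probability.LatticeModels.Site 4 × Fin 4 =>
        ((x + Torus.proj (2 * S + 1) q.1, q.2) : Edge 4 (2 * S + 1))) =
      (R.image Prod.fst ∪ R.image fun q => q.1 + Pi.single q.2 1).image
        fun a => x + Torus.proj (2 * S + 1) a := by
  classical
  ext z
  simp only [touched, Finset.mem_filter, Finset.mem_univ, true_and, Finset.mem_image, Finset.mem_union]
  constructor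
  · rintro ⟨e, ⟨q, hq, rfl⟩, h | h⟩
    · exact ⟨q.1, Or.inl ⟨q, hq, rfl⟩, h⟩
    · refine ⟨q.1 + Pi.single q.2 1, Or.inr ⟨q, hq, rfl⟩, ?_⟩
      rw [← h, (proj_add_single_sub_single _ q.1 q.2).1]
      exact (add_assoc _ _ _).symm
  · rintro ⟨y, (⟨q, hq, rfl⟩ | ⟨q, hq, rfl⟩), rfl⟩
    · exact ⟨_, ⟨q, hq, rfl⟩, Or.inl rfl⟩
    · refine ⟨_, ⟨q, hq, rfl⟩, Or.inr ?_⟩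
      show _ + Pi.single q.2 1 = _
      rw [(proj_add_single_sub_single _ q.1 q.2).1, add_assoc]

/-- **Even boxes in the chart**: for `a` in the window and `r + 1 ≤ S`, `φ a ∈ ebox S x r ↔ a ∈ [-r-1, r]⁴`; the
backward direction holds unconditionally. [folklore] -/
theorem mem_ebox_chart {S : ℕ} (x : TorusSite 4 (2 * S + 1)) (a : Literature.Probability.LatticeModels.Site 4) (r : ℕ) :
    ((∀ i, -(r : ℤ) - 1 ≤ a i ∧ a i ≤ r) → x + Torus.proj (2 * S + 1) a ∈ ebox S x r) ∧
    ((r : ℤ) + 1 ≤ S → (∀ i, -(S : ℤ) ≤ a i ∧ a i ≤ S) →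
      x + Torus.proj (2 * S + 1) a ∈ ebox S x r → ∀ i, -(r : ℤ) - 1 ≤ a i ∧ a i ≤ r) := by
  refine ⟨fun h => (mem_ebox_iff _ _ _).2 ⟨a, h, rfl⟩, fun hr ha h => ?_⟩
  obtain ⟨w, hw, h'⟩ := (mem_ebox_iff _ _ _).1 h
  have := chart_inj x a w ha (fun i => ⟨by linarith [(hw i).1], by linarith [(hw i).2]⟩) h'
  subst this
  exact hw

/-- **Cores in the chart**: `a - b ∈ {-1, 0}⁴` puts `φ a` in the `2⁴` core of the pad about `φ b`. [folklore] -/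
theorem mem_ebox_core_chart {S : ℕ} (x : TorusSite 4 (2 * S + 1)) (a b : Literature.Probability.LatticeModels.Site 4)
    (h : ∀ i, a i - b i = 0 ∨ a i - b i = -1) :
    x + Torus.proj (2 * S + 1) a ∈ ebox S (x + Torus.proj (2 * S + 1) b) 0 := by
  refine (mem_ebox_iff _ _ _).2 ⟨a - b, fun i => ?_, ?_⟩
  · rcases h i with h | h <;> simp only [Pi.sub_apply] at h ⊢ <;> push_cast <;> omega
  · rw [proj_sub', add_assoc, add_sub_cancel]

/-- **Balance in the chart**: the image of a window set carrying a nearest-neighbour involution is balanced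
(`Balanced`, every proper two-colouring has equal classes). [folklore] -/
theorem balanced_chart_image {S : ℕ} (x : TorusSite 4 (2 * S + 1))
    (T : Finset (Literature.Probability.LatticeModels.Site 4)) (hT : ∀ a ∈ T, ∀ i, -(S : ℤ) ≤ a i ∧ a i ≤ S)
    (σ : Literature.Probability.LatticeModels.Site 4 → Literature.Probability.LatticeModels.Site 4)
    (h1 : ∀ a ∈ T, σ a ∈ T) (h2 : ∀ a ∈ T, σ (σ a) = a)
    (h3 : ∀ a ∈ T, ∃ μ : Fin 4, σ a = a + Pi.single μ 1 ∨ a = σ a + Pi.single μ 1) :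
    Balanced (T.image fun a => x + Torus.proj (2 * S + 1) a) := by
  classical
  obtain ⟨hv, hva⟩ := chart_val x
  intro χ hχ
  refine card_filter_eq_of_pairing _
    (fun z => x + Torus.proj (2 * S + 1) (σ fun i => ((z i - x i).valMinAbs : ℤ))) ?_ ?_ ?_ χ hχ
  · intro z hz
    obtain ⟨a, ha, rfl⟩ := Finset.mem_image.1 hz
    rw [hva a (hT a ha)]
    exact Finset.mem_image_of_mem _ (h1 a ha)
  · intro z hz
    obtain ⟨a, ha, rfl⟩ := Finset.mem_image.1 hz
    rw [hva a (hT a ha), hva _ (hT _ (h1 a ha)), h2 a ha]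
  · intro z hz
    obtain ⟨a, ha, rfl⟩ := Finset.mem_image.1 hz
    rw [hva a (hT a ha)]
    obtain ⟨μ, h | h⟩ := h3 a ha
    · exact ⟨μ, Or.inl (by rw [h, (proj_add_single_sub_single _ a μ).1, add_assoc])⟩
    · refine ⟨μ, Or.inr ?_⟩
      conv_lhs => rw [h]
      rw [(proj_add_single_sub_single _ (σ a) μ).1, add_assoc]

/-- **Canonical pad regions in the chart.**  If `Q` contains every `(b + w, μ)` with `w, w + e_μ ∈ [-2,1]⁴` both
unfrozen and consists of such pairs with not both endpoints frozen (frozen: `w_k = c_k` for some `k ∈ M`), then its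
image is a canonical pad region about `φ b` (`IsPadRegion`), for `b` at distance `≥ 2` from the edge of the window.
[folklore] -/
theorem isPadRegion_chart {S : ℕ} (x : TorusSite 4 (2 * S + 1)) (b : Literature.Probability.LatticeModels.Site 4)
    (hb : ∀ i, -(S : ℤ) + 2 ≤ b i ∧ b i ≤ S - 2) (M : Finset (Fin 4)) (c : Literature.Probability.LatticeModels.Site 4)
    (hc : ∀ k ∈ M, c k = -2 ∨ c k = 1) (Q : Finset (Literature.Probability.LatticeModels.Site 4 × Fin 4))
    (hlower : ∀ w : Literature.Probability.LatticeModels.Site 4, (∀ i, -2 ≤ w i ∧ w i ≤ 1) → ∀ μ : Fin 4,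
        (∀ i, -2 ≤ (w + Pi.single μ 1 : Literature.Probability.LatticeModels.Site 4) i ∧
          (w + Pi.single μ 1 : Literature.Probability.LatticeModels.Site 4) i ≤ 1) →
        (¬ ∃ k ∈ M, w k = c k) →
        (¬ ∃ k ∈ M, (w + Pi.single μ 1 : Literature.Probability.LatticeModels.Site 4) k = c k) → (b + w, μ) ∈ Q)
    (hupper : ∀ q ∈ Q, ∃ w : Literature.Probability.LatticeModels.Site 4, (∀ i, -2 ≤ w i ∧ w i ≤ 1) ∧
        (∀ i, -2 ≤ (w + Pi.single q.2 1 : Literature.Probability.LatticeModels.Site 4) i ∧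
          (w + Pi.single q.2 1 : Literature.Probability.LatticeModels.Site 4) i ≤ 1) ∧
        q.1 = b + w ∧ ¬ ((∃ k ∈ M, w k = c k) ∧
          (∃ k ∈ M, (w + Pi.single q.2 1 : Literature.Probability.LatticeModels.Site 4) k = c k))) :
    IsPadRegion S (x + Torus.proj (2 * S + 1) b)
      (Q.image fun q : Literature.Probability.LatticeModels.Site 4 × Fin 4 =>
        ((x + Torus.proj (2 * S + 1) q.1, q.2) : Edge 4 (2 * S + 1))) := by
  classical
  -- chart facts about the pad about `x' = φ b`
  have hφ : ∀ w : Literature.Probability.LatticeModels.Site 4,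
      x + Torus.proj (2 * S + 1) b + Torus.proj (2 * S + 1) w = x + Torus.proj (2 * S + 1) (b + w) := fun w => by
    rw [proj_add', add_assoc]
  have hφs : ∀ (w : Literature.Probability.LatticeModels.Site 4) (μ : Fin 4),
      x + Torus.proj (2 * S + 1) (b + w) + Pi.single μ 1 = x + Torus.proj (2 * S + 1) (b + (w + Pi.single μ 1)) :=
    fun w μ => by rw [← add_assoc b, (proj_add_single_sub_single _ (b + w) μ).1, add_assoc]
  have hwin : ∀ w : Literature.Probability.LatticeModels.Site 4, (∀ i, -2 ≤ w i ∧ w i ≤ 2) →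
      ∀ i, -(S : ℤ) ≤ (b + w) i ∧ (b + w) i ≤ S := by
    intro w hw i; have := hb i; have := hw i; simp only [Pi.add_apply]; omega
  have hbs : ∀ (w : Literature.Probability.LatticeModels.Site 4) (μ : Fin 4), (∀ i, -2 ≤ w i ∧ w i ≤ 1) →
      ∀ i, -2 ≤ (w + Pi.single μ 1 : Literature.Probability.LatticeModels.Site 4) i ∧
        (w + Pi.single μ 1 : Literature.Probability.LatticeModels.Site 4) i ≤ 2 := by
    intro w μ hw i
    have := hw i
    by_cases hi : i = μ
    · subst hi; simp; omega
    · simp [hi]; omega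
  have cast1 : ∀ w : Literature.Probability.LatticeModels.Site 4,
      (∀ i, -2 ≤ w i ∧ w i ≤ 1) ↔ (∀ i, -((1 : ℕ) : ℤ) - 1 ≤ w i ∧ w i ≤ ((1 : ℕ) : ℤ)) := by
    intro w; push_cast; norm_num
  have hpad : ∀ w : Literature.Probability.LatticeModels.Site 4, (∀ i, -2 ≤ w i ∧ w i ≤ 1) →
      x + Torus.proj (2 * S + 1) (b + w) ∈ ebox S (x + Torus.proj (2 * S + 1) b) 1 := fun w hw =>
    (mem_ebox_iff _ _ _).2 ⟨w, (cast1 w).1 hw, (hφ w).symm⟩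
  have hpad' : ∀ z, z ∈ ebox S (x + Torus.proj (2 * S + 1) b) 1 →
      ∃ w : Literature.Probability.LatticeModels.Site 4, (∀ i, -2 ≤ w i ∧ w i ≤ 1) ∧
        z = x + Torus.proj (2 * S + 1) (b + w) := fun z hz => by
    obtain ⟨w, hw, rfl⟩ := (mem_ebox_iff _ _ _).1 hz
    exact ⟨w, (cast1 w).2 hw, hφ w⟩
  have hfro : ∀ w : Literature.Probability.LatticeModels.Site 4, (∀ i, -2 ≤ w i ∧ w i ≤ 1) →
      (x + Torus.proj (2 * S + 1) (b + w) ∈ padFrozen S (x + Torus.proj (2 * S + 1) b) M c ↔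
        ∃ k ∈ M, w k = c k) := by
    intro w hw
    simp only [padFrozen, Finset.mem_image, Finset.mem_filter, Fintype.mem_piFinset, Finset.mem_Icc]
    constructor
    · rintro ⟨w', ⟨hw', hfr⟩, h⟩
      rw [hφ] at h
      have h' := chart_inj x _ _ (hwin w' fun i => by have := hw' i; omega)
        (hwin w fun i => by have := hw i; omega) h
      have : w' = w := add_left_cancel h'
      subst this
      exact hfr
    · intro hfr
      exact ⟨w, ⟨fun i => by have := hw i; omega, hfr⟩, hφ w⟩
  refine ⟨M, c, hc, ?_, ?_⟩
  · -- lower inclusion: unfrozen pad links belong to the region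
    intro e he
    rw [Finset.mem_filter] at he
    obtain ⟨hpl, hn1, hn2⟩ := he
    simp only [padLinks, Finset.mem_filter, Finset.mem_univ, true_and] at hpl
    obtain ⟨w, hw, he1⟩ := hpad' _ hpl.1
    obtain ⟨w', hw', he2⟩ := hpad' _ hpl.2
    have he2' : Site.shift e.1 e.2 = x + Torus.proj (2 * S + 1) (b + (w + Pi.single e.2 1)) := by
      show e.1 + Pi.single e.2 1 = _
      rw [he1, hφs]
    have hww : w + Pi.single e.2 1 = w' := by
      have h' := chart_inj x _ _ (hwin _ (hbs w e.2 hw)) (hwin w' fun i => by have := hw' i; omega)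
        (he2'.symm.trans he2)
      exact add_left_cancel h'
    have hwb : ∀ i, -2 ≤ (w + Pi.single e.2 1 : Literature.Probability.LatticeModels.Site 4) i ∧
        (w + Pi.single e.2 1 : Literature.Probability.LatticeModels.Site 4) i ≤ 1 := by
      rw [hww]; exact hw'
    have hfr1 : ¬ ∃ k ∈ M, w k = c k := fun h => hn1 (by rw [he1]; exact (hfro w hw).2 h)
    have hfr2 : ¬ ∃ k ∈ M, (w + Pi.single e.2 1 : Literature.Probability.LatticeModels.Site 4) k = c k :=
      fun h => hn2 (by rw [he2']; exact (hfro _ hwb).2 h)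
    refine Finset.mem_image.2 ⟨(b + w, e.2), hlower w hw e.2 hwb hfr1 hfr2, ?_⟩
    exact Prod.ext he1.symm rfl
  · -- upper inclusion: region links are pad links with not both endpoints frozen
    intro e he
    obtain ⟨q, hq, rfl⟩ := Finset.mem_image.1 he
    obtain ⟨w, hw, hw', hq1, hfr⟩ := hupper q hq
    rw [Finset.mem_filter]
    have he2 : Site.shift (x + Torus.proj (2 * S + 1) q.1) q.2 =
        x + Torus.proj (2 * S + 1) (b + (w + Pi.single q.2 1)) := by
      show _ + Pi.single q.2 1 = _
      rw [hq1, hφs]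
    refine ⟨?_, fun h => hfr ⟨?_, ?_⟩⟩
    · simp only [padLinks, Finset.mem_filter, Finset.mem_univ, true_and]
      refine ⟨?_, ?_⟩
      · rw [hq1]; exact hpad w hw
      · rw [he2]; exact hpad _ hw'
    · have h1 := h.1
      rw [hq1] at h1
      exact (hfro w hw).1 h1
    · have h2 := h.2
      rw [he2] at h2
      exact (hfro _ hw').1 h2

/-- **Registered helper `stub_placementCollar_aux5` of crux stmt-QuantumFields-17375** (line `pad-the-fibre`, stub
`stub_placementCollar`): a region canonical in the chart is a canonical pad region on the torus — one line (`isPadRegion_chart`). [folklore] -/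
theorem stub_placementCollar_aux5 : ∀ (S : ℕ) (x : TorusSite 4 (2 * S + 1)) (b : Literature.Probability.LatticeModels.Site 4) (_ : ∀ i, -(S : ℤ) + 2 ≤ b i ∧ b i ≤ S - 2) (M : Finset (Fin 4)) (c : Literature.Probability.LatticeModels.Site 4) (_ : ∀ k ∈ M, c k = -2 ∨ c k = 1) (Q : Finset (Literature.Probability.LatticeModels.Site 4 × Fin 4)) (_ : ∀ w : Literature.Probability.LatticeModels.Site 4, (∀ i, -2 ≤ w i ∧ w i ≤ 1) → ∀ μ : Fin 4, (∀ i, -2 ≤ (w + Pi.single μ 1 : Literature.Probability.LatticeModels.Site 4) i ∧ (w + Pi.single μ 1 : Literature.Probability.LatticeModels.Site 4) i ≤ 1) → (¬ ∃ k ∈ M, w k = c k) → (¬ ∃ k ∈ M, (w + Pi.single μ 1 : Literature.Probability.LatticeModels.Site 4) k = c k) → (b + w, μ) ∈ Q) (_ : ∀ q ∈ Q, ∃ w : Literature.Probability.LatticeModels.Site 4, (∀ i, -2 ≤ w i ∧ w i ≤ 1) ∧ (∀ i, -2 ≤ (w + Pi.single q.2 1 : Literature.Probability.LatticeModels.Site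 4) i ∧ (w + Pi.single q.2 1 : Literature.Probability.LatticeModels.Site 4) i ≤ 1) ∧ q.1 = b + w ∧ ¬ ((∃ k ∈ M, w k = c k) ∧ (∃ k ∈ M, (w + Pi.single q.2 1 : Literature.Probability.LatticeModels.Site 4) k = c k))), IsPadRegion S (x + Torus.proj (2 * S + 1) b) (Q.image fun q : Literature.Probability.LatticeModels.Site 4 × Fin 4 => ((x + Torus.proj (2 * S + 1) q.1, q.2) : Edge 4 (2 * S + 1))) :=
  fun S x => isPadRegion_chart (S := S) x

end Summit.QuantumFields.QCD.Theorems.PadTheFibreCollar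

end
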